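import Summits.Ventures.AbcSig.Rows.XTemplateHalves
import Summits.Ventures.AbcSig.Levels.N3104

/-!
# Venture AbcSig — PARITY-HALF ROW `C2aL97A3yodd`: `xⁿ + 8·97^m·yⁿ = z²`, `y` odd (class `a = 3`, clean level only) over the NORM-FORM level file 3104 = 32·97 (GENERATED by p-lean g4 `gen4/halfrow.py`)

HONEST FRAMING. A row of a COMPUTATION cell (`pub-abcsig`); a CONDITIONAL theorem, no claim on ABC or any summit.
Hypotheses: `BS04Package` (CITED: [BS04] Lemma 3.3 + (3.1) + Lemma 4.2); `DataComplete 3104` + `RefinesCPSymAll 3104` (COMPUTED: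
certified engine-1 level file; norm-form certificates `Sieve/CharpolyCert.lean`, prime-ideal trees where the norm form is weaker);
the listed per-orbit exclusions `hX_…` (CITED: the row of record's module closures — nothing of them is checked here).
Only the parity half living at the single level 32·97 is claimed (the complementary half needs level 2·97, not certified).
Exponent range: prime `n ≥ 11`, `n ≠ 97`; `1 ≤ m < n`.
Residual of record: none. CITED per the row of record's R3: 3104.9 @ 29: M6c-old.
Row of record: `census/rows/C2a/C2a-l97-a3-yodd.md` (sha16 `aee15a47241ca681`; SIGNED 2026-08-22T16:05:08Z by referee (ref-g11)).
-/

namespace Summit.Ventures.AbcSig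

/-- Parity-half row `C2aL97A3yodd` (`xⁿ + 8·97^m·yⁿ = z²`, `y` odd (class `a = 3`, clean level only)); prime `n ≥ 11`, `n ≠ 97`; conditional on the named hypotheses. -/
theorem xrow_C2aL97A3yodd (M : NewformModel) (hP : M.BS04Package)
    (hD3104 : M.DataComplete 3104 level3104Orbits) (hCP3104 : M.RefinesCPSymAll 3104 level3104CP)
    (n : ℕ) (hn : n.Prime) (hmin : 11 ≤ n) (hnℓ : n ≠ 97) (m : ℕ) (hm : 1 ≤ m) (hmn : m < n)
    (hX_orbit_3104_9 : n ∈ ([29] : List ℕ) → M.Excludes 3104 orbit_3104_9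
      (famB (2 ^ 3 * 97 ^ m) n (fun _ _ => True)))
    (x y z : ℤ) (hy : ¬ 2 ∣ y) (hxy1 : x * y ≠ 1) (hxy2 : x * y ≠ -1) : ¬ IsPrimitiveSolution 1 (2 ^ 3 * 97 ^ m) 1 n x y z := by
  have hℓ : Nat.Prime 97 := by norm_num
  have h7 : 7 ≤ n := by omega
  exact xrowC2a_a3_yodd 97 hℓ (by norm_num) M hP n hn h7 hnℓ hD3104 m hm hmn
    (level3104_sieve M hP hCP3104 n hn h7 (fun o => M.Excludes 3104 o
      (famB (2 ^ 3 * 97 ^ m) n (fun _ _ => True)) ∨ M.ExcludesStd 3104 o n) (fun _ h => Or.inr h) (fun hmem => by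
      obtain rfl : n = 7 := by simpa using hmem
      omega) (fun hmem => by
      obtain rfl : n = 7 := by simpa using hmem
      omega) (fun hmem => by
      obtain rfl : n = 7 := by simpa using hmem
      omega) (fun hmem => by
      obtain rfl : n = 7 := by simpa using hmem
      omega) (fun hmem => by
      obtain rfl : n = 7 := by simpa using hmem
      omega) (fun hmem => by
      obtain rfl : n = 29 := by simpa using hmem
      exact Or.inl (hX_orbit_3104_9 (by simp))))
    x y z hy hxy1 hxy2

end Summit.Ventures.AbcSig
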